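import Mathlib
import Summits.Ventures.PercRepro2.V2SP
import Summits.Ventures.PercRepro2.Tail2DPathFlip
import Summits.Ventures.PercRepro2.Tail2DPathAvg
import Summits.Ventures.PercRepro2.Tail2DTailAvg
import Summits.Ventures.PercRepro2.Tail2DMaskCC
import Summits.Ventures.PercRepro2.Tail2DMaskDiag

/-!
# Leaf-parallel patterns: the tail-average monotonicity and the anti-diagonal unimodality, unconditionally
(seat mine-b, cell pub-perc-repro2; MINE-B.md §40.9)

`LeafPar` is the class of patterns generated from the atoms by series composition and by parallel composition
with a single free edge (every parallel node has a leaf child: bundles, series of bundles, `(B₂ ∧ B₃) ∥ e`, …).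
By `Tail2DMaskDiag.lean` the diagonal masked family `D_i ≤ 0` and the count inequality (MT″) are closed under
both operations and hold on the atoms (`maskDZ_free`, `maskTZ_free`, …), so they hold on every leaf-parallel
pattern (`leafPar_maskDZ`); the tail-average position is `D_1` (`maskCC_eq_maskDZ`), so `CC_m ≤ 0` for every mask,
`(T-AVG)` holds at every tail point (`tailAvg_of_leafPar`) and the WHOLE anti-diagonal unimodality of the tails
`T(a,j) ≤ T(a−1,j+1)`, `j + 2 ≤ a`, is a theorem on the class — every member, the wall `(7,5)` included
(`offaxis_of_leafPar`).  The reduction of `Tail2DMaskCC.maskD_all_of_par` is restated with the DIAGONAL family as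
the hypothesis family (`maskDZ_all_of_par`, `offaxis_all_of_maskDiagPar`): its region `{α′ < α, α+γ ≤ α′+γ′}`
contains the cell `(1,2)`, which is false on 8-edge patterns, whereas the diagonal is census-clean.
-/

namespace Summit.Ventures.PercRepro2.Tail2D

open V2Closure

section Atoms

/-- the diagonal family on the free edge -/
theorem maskDZ_free (m : SP.free.Conf) (u : ℤ × ℤ) (i : ℤ) (hi : 1 ≤ i) : maskDZ SP.free m u i ≤ 0 := by
  unfold maskDZ maskD
  refine (Fintype.sum_bool _).trans_le ?_
  cases m <;> simp only [xorConf, Bool.xor_false, Bool.xor_true, Bool.not_true, Bool.not_false, SP.rLab, SP.bLab,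
    bp_free, if_true, if_false, Bool.false_eq_true] <;> split_ifs <;> omega

/-- the diagonal family on the absent edge -/
theorem maskDZ_absent (m : SP.absent.Conf) (u : ℤ × ℤ) (i : ℤ) : maskDZ SP.absent m u i ≤ 0 :=
  maskD_absent m _ _ _ _

/-- (MT″) on the free edge -/
theorem maskTZ_free (m : SP.free.Conf) (u : ℤ × ℤ) (i : ℤ) (hi : 1 ≤ i) :
    maskTZ SP.free m (u.1 + 1, u.2 - 1) (i + 1) ≤ maskTZ SP.free m u (i - 1) := by
  unfold maskTZ maskT
  refine le_of_eq_of_le (Fintype.sum_bool _) (le_of_le_of_eq ?_ (Fintype.sum_bool _).symm)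
  cases m <;> simp only [xorConf, Bool.xor_false, Bool.xor_true, Bool.not_true, Bool.not_false, SP.rLab, SP.bLab,
    if_true, if_false, Bool.false_eq_true] <;> split_ifs <;> omega

/-- (MT″) on the absent edge -/
theorem maskTZ_absent (m : SP.absent.Conf) (u : ℤ × ℤ) (i : ℤ) (hi : 1 ≤ i) :
    maskTZ SP.absent m (u.1 + 1, u.2 - 1) (i + 1) ≤ maskTZ SP.absent m u (i - 1) := by
  unfold maskTZ maskT
  refine Finset.sum_le_sum (fun x _ => ?_)
  simp only [SP.rLab, SP.bLab]
  split_ifs <;> omega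

end Atoms

section LeafPar

/-- patterns generated from the atoms by series composition and by parallel composition with a single free edge
(every parallel node has a leaf child) -/
inductive LeafPar : SP → Prop
  | free : LeafPar .free
  | absent : LeafPar .absent
  | ser {s t : SP} : LeafPar s → LeafPar t → LeafPar (.ser s t)
  | parFree {s : SP} : LeafPar s → LeafPar (.par s .free)
  | freePar {s : SP} : LeafPar s → LeafPar (.par .free s)

/-- leaf-parallel patterns are pin-free -/
theorem LeafPar.pinFree : ∀ {s : SP}, LeafPar s → PinFree s
  | _, .free => PinFree.free
  | _, .absent => PinFree.absent
  | _, .ser hs ht => PinFree.ser hs.pinFree ht.pinFree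
  | _, .parFree hs => PinFree.par hs.pinFree PinFree.free
  | _, .freePar hs => PinFree.par PinFree.free hs.pinFree

/-- **the diagonal masked family and (MT″) hold on every leaf-parallel pattern** -/
theorem leafPar_maskDZ : ∀ {s : SP}, LeafPar s →
    (∀ (m : s.Conf) (u : ℤ × ℤ) (i : ℤ), 1 ≤ i → maskDZ s m u i ≤ 0)
    ∧ (∀ (m : s.Conf) (u : ℤ × ℤ) (i : ℤ), 1 ≤ i → maskTZ s m (u.1 + 1, u.2 - 1) (i + 1) ≤ maskTZ s m u (i - 1))
  | _, .free => ⟨fun m u i hi => maskDZ_free m u i hi, fun m u i hi => maskTZ_free m u i hi⟩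
  | _, .absent => ⟨fun m u i _ => maskDZ_absent m u i, fun m u i hi => maskTZ_absent m u i hi⟩
  | _, .ser hs ht =>
      ⟨fun m u i hi => maskDZ_ser _ _ m u i ((leafPar_maskDZ hs).1 m.1 u i hi) ((leafPar_maskDZ ht).1 m.2 u i hi),
       fun m u i hi => maskTZ_ser_le _ _ m u i ((leafPar_maskDZ hs).2 m.1 u i hi) ((leafPar_maskDZ ht).2 m.2 u i hi)⟩
  | _, .parFree hs =>
      ⟨fun m u i hi => maskDZ_par_free _ (leafPar_maskDZ hs).1 (leafPar_maskDZ hs).2 m u i hi,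
       fun m u i hi => maskTZ_par_free _ (leafPar_maskDZ hs).2 m u i hi⟩
  | _, .freePar hs =>
      ⟨fun m u i hi => maskDZ_free_par _ (leafPar_maskDZ hs).1 (leafPar_maskDZ hs).2 m u i hi,
       fun m u i hi => maskTZ_free_par _ (leafPar_maskDZ hs).2 m u i hi⟩

/-- the tail-average position is the diagonal position with parameter `1` -/
theorem maskCC_eq_maskDZ (s : SP) (m : s.Conf) (a c : ℕ) (ha : 1 ≤ a) :
    maskCC s m a c = maskDZ s m ((a : ℤ), (c : ℤ)) 1 := by
  unfold maskCC maskDZ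
  have e1 : ((a : ℤ)).toNat = a := by omega
  have e2 : ((c : ℤ)).toNat = c := by omega
  have e3 : ((a : ℤ) - 1).toNat = a - 1 := by omega
  have e4 : ((c : ℤ) + 1).toNat = c + 1 := by omega
  rw [e1, e2, e3, e4]

/-- **(T-AVG) at every tail point of every leaf-parallel pattern** (unconditional) -/
theorem tailAvg_of_leafPar {s : SP} (hs : LeafPar s) (a c : ℕ) (ha : 1 ≤ a) : TailAvg s a c :=
  tailAvg_of_maskCC s a c (fun m => by
    rw [maskCC_eq_maskDZ s m a c ha]
    exact (leafPar_maskDZ hs).1 m _ 1 le_rfl)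

/-- **the whole anti-diagonal unimodality of the tails on every leaf-parallel pattern** (unconditional):
`T(a,j) ≤ T(a−1,j+1)` for `j + 2 ≤ a` -/
theorem offaxis_of_leafPar {s : SP} (hs : LeafPar s) (a j : ℕ) (hja : j + 2 ≤ a) :
    (Finset.univ.filter (fun x : s.Conf => a ≤ s.rLab x ∧ j ≤ s.bLab x)).card
      ≤ (Finset.univ.filter (fun x : s.Conf => a - 1 ≤ s.rLab x ∧ j + 1 ≤ s.bLab x)).card := by
  have h := offaxis_of_tailAvg hs.pinFree (fun a' c' h' => tailAvg_of_leafPar hs a' c' h') j a (by omega)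
  unfold tailCount at h
  rw [tail_symm s a j, tail_symm s (a - 1) (j + 1)]
  exact h

end LeafPar

section Reduction

/-- **the reduction, corrected**: the diagonal family on every pin-free pattern as soon as its PARALLEL step holds
(the region of `Tail2DMaskCC.maskD_all_of_par` is too large — `(α−α', γ'−γ) = (1,2)` fails on 8-edge patterns —
the diagonal `{(i,i) : i ≥ 1}` is the census-clean closed set) -/
theorem maskDZ_all_of_par
    (hpar : ∀ s t : SP, PinFree s → PinFree t →
      (∀ (m : s.Conf) (u : ℤ × ℤ) (i : ℤ), 1 ≤ i → maskDZ s m u i ≤ 0) →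
      (∀ (m : t.Conf) (u : ℤ × ℤ) (i : ℤ), 1 ≤ i → maskDZ t m u i ≤ 0) →
      ∀ (m : (SP.par s t).Conf) (u : ℤ × ℤ) (i : ℤ), 1 ≤ i → maskDZ (SP.par s t) m u i ≤ 0) :
    ∀ {s : SP}, PinFree s → ∀ (m : s.Conf) (u : ℤ × ℤ) (i : ℤ), 1 ≤ i → maskDZ s m u i ≤ 0
  | .free, _, m, u, i, hi => maskDZ_free m u i hi
  | .absent, _, m, u, i, _ => maskDZ_absent m u i
  | .ser s t, .ser hs ht, m, u, i, hi =>
      maskDZ_ser s t m u i (maskDZ_all_of_par hpar hs m.1 u i hi) (maskDZ_all_of_par hpar ht m.2 u i hi)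
  | .par s t, .par hs ht, m, u, i, hi =>
      hpar s t hs ht (fun m' u' i' h' => maskDZ_all_of_par hpar hs m' u' i' h')
        (fun m' u' i' h' => maskDZ_all_of_par hpar ht m' u' i' h') m u i hi

/-- **the whole anti-diagonal unimodality of the tails on every pin-free pattern, under the parallel step of the
DIAGONAL masked family** -/
theorem offaxis_all_of_maskDiagPar
    (hpar : ∀ s t : SP, PinFree s → PinFree t →
      (∀ (m : s.Conf) (u : ℤ × ℤ) (i : ℤ), 1 ≤ i → maskDZ s m u i ≤ 0) →
      (∀ (m : t.Conf) (u : ℤ × ℤ) (i : ℤ), 1 ≤ i → maskDZ t m u i ≤ 0) →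
      ∀ (m : (SP.par s t).Conf) (u : ℤ × ℤ) (i : ℤ), 1 ≤ i → maskDZ (SP.par s t) m u i ≤ 0)
    {s : SP} (hs : PinFree s) (a j : ℕ) (hja : j + 2 ≤ a) :
    (Finset.univ.filter (fun x : s.Conf => a ≤ s.rLab x ∧ j ≤ s.bLab x)).card
      ≤ (Finset.univ.filter (fun x : s.Conf => a - 1 ≤ s.rLab x ∧ j + 1 ≤ s.bLab x)).card := by
  have hT : ∀ a' c', 1 ≤ a' → TailAvg s a' c' := fun a' c' h' =>
    tailAvg_of_maskCC s a' c' (fun m => by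
      rw [maskCC_eq_maskDZ s m a' c' h']
      exact maskDZ_all_of_par hpar hs m _ 1 le_rfl)
  have h := offaxis_of_tailAvg hs hT j a (by omega)
  unfold tailCount at h
  rw [tail_symm s a j, tail_symm s (a - 1) (j + 1)]
  exact h

end Reduction

end Summit.Ventures.PercRepro2.Tail2D
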